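import Mathlib
import HarnessLib

/-!
# Counting `γ`-invariant classes modulo `p^m` along a layer filtration — the pure algebra of the
# B3 corank bound (cell `b2b-bsdres`, CLASS-CLOSURE lane, class O10 — x1b GEN 39, class lead;
# file 79 of the series)

HONEST FRAMING (cell `b2b-bsdres`, run/shared/lean/b2b/bsd-rank1-residual/, verbatim in every
file): the goal of the cell is to DELETE the COMBINATION-SHAPED residual classes of the
Birch–Swinnerton-Dyer formula for ALL analytic-rank `≤ 1` elliptic curves over `ℚ` — "full BSD
formula for every rank `≤ 1` curve in class `C`" assembled STRICTLY from published theorems — so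
that the rank-`≤ 1` remainder becomes exactly the CONSTRUCTION-SHAPED classes, which are TYPED
(missing-input `Prop`s), NOT attempted. This is not "finishing BSD". CLASS-CLOSURE lane: prove
what is provable now; shrink each hard class to its core with data; no claim beyond stated classes;
research routes on CONSTRUCTION-SHAPED X12 / O10; census / instrument output = EVIDENCE / conjecture
items, NEVER a Literature fact; `RESIDUAL-MAP.md` marks change only by signed lines. THIS FILE:
PURE ALGEBRA, TOOL THEOREMS ONLY — no definition, no named Literature fact, no `sorry`, axioms
standard; nothing is booked; no label / mark / count / sub-cell moves; nothing about any curve.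

## Why (the B3 corank bound without Coleman maps)

Brick B3 of the count (C) (files 60–78) asks for the level-`m` minus line at `p`:
`#C⁻_η[p^m] = p^m`, i.e. that Kobayashi's minus condition pulled back to the bottom layer is a
divisible group of corank one ([Kobayashi2003] Thm. 6.2 via the Coleman map `Col⁻`). Transversality
with the Kummer line (`u(p) = 0`, kernel since GEN 31) bounds it ABOVE; this file is the algebra of
the bound BELOW, by an elementary count that replaces the Coleman map: for the zero-clause minus
group `N = E⁻(K_n·E) ∩ ker Tr_{n/0}` with its layer filtration `F_k = N ∩ E(K_k·E)` and `γ` a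
generator of the layer quotients,
* the `γ`-coinvariants inject along the filtration (`(E(K_{k+1})/E(K_k))^γ = 0`, §3);
* every ODD layer contributes a coinvariant class of order exactly `p` as soon as it carries a minus
  point not `≡` a lower point modulo `p` (§4–§7: `(γ − 1)^{p^{k}} ≡ 0 mod p` on `E(K_k)`);
* hence `p^{#layers}` classes modulo `(γ − 1)N` (§8), all killed by `p^n` (§6), so `p^{min(m,c)}` of
  them killed by `p^m` (§9), which convert into `p^{min(m,c)}` points `x ∈ N` with `γx ≡ x mod p^m N`,
  pairwise incongruent modulo `p^m N` (§10–§11).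
Their Kummer classes are `p^{min(m,c)}` distinct `Gal(K_n·E/E)`-invariant classes in
`H¹(K_n·E, E[p^m])`, which descend to the bottom layer (no `p`-torsion) inside the level-`m` minus
condition: `#C⁻_η[p^m] ≥ p^m` once `c ≥ m` odd layers carry a new minus point — file 81 applies this
to the tree's tower; the descent is the cohomological half (next files).

## What (all `[folklore]`; `A` an abelian group, `γ ∈ End_ℤ(A)`, `p` prime)

§1 power identities (`γ^i x = x + Σ_{j<i} γ^j(γ−1)x`, telescoping, `Σ_{i<N} γ^i x = N x + (γ−1)D`);
§2 stability; §3 `mem_of_sub_one_apply_mem` (`(V/V')^γ = 0`); §4 `exists_sub_one_pow_apply_eq_smul`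
(`(γ−1)^{p^{k+1}} F ⊆ pF`, binomial theorem + `p ∣ C(p^{k+1}, i)`); §5 `exists_not_mem_sup` (witness
conversion); §6 `exists_sub_one_apply_eq_pow_smul` (`p^n N ⊆ (γ−1)N` when `N^γ = 0`);
§7 `exists_not_mem_and_smul_mem`; §8 two bookkeeping lemmas. The finset count (§8–§10) and the
main theorem `exists_finset_invariant_mod_pow` (§11) are file 80 `InvariantClassCountAssembly`; the
application to Kobayashi's zero-clause minus group over the `κ`-tower is file 81.

References: [Kobayashi2003] S. Kobayashi, Invent. Math. 152 (2003), Thm. 6.2 (p. 11), Prop. 8.12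
(p. 17), §2 p. 4; [GreenbergLNM1716] R. Greenberg, LNM 1716, §3 (coinvariant counts `|ker r_v|`).
-/

noncomputable section

open scoped Classical

namespace Summit.BirchSwinnertonDyer.Rank1Residual.Additive.InvariantCount

variable {A : Type*} [AddCommGroup A] (γ : Module.End ℤ A)

/-! ### §1 Identities for the powers of `γ` -/

/-- `γ^i x = x + Σ_{j<i} γ^j((γ − 1)x)`. [folklore] -/
theorem pow_apply_eq_add_sum (x : A) : ∀ i : ℕ,
    (γ ^ i) x = x + ∑ j ∈ Finset.range i, (γ ^ j) ((γ - 1) x)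
  | 0 => by simp
  | i + 1 => by
    rw [pow_succ', Module.End.mul_apply, pow_apply_eq_add_sum x i, map_add, map_sum,
      Finset.sum_range_succ', pow_zero, Module.End.one_apply]
    have h : ∀ j : ℕ, γ ((γ ^ j) ((γ - 1) x)) = (γ ^ (j + 1)) ((γ - 1) x) := fun j => by
      rw [pow_succ', Module.End.mul_apply]
    simp_rw [h]
    rw [LinearMap.sub_apply, Module.End.one_apply]
    abel

/-- Telescoping: `(γ − 1)(Σ_{j<M} γ^j y) = γ^M y − y`. [folklore] -/
theorem sub_one_apply_sum_pow (y : A) (M : ℕ) :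
    (γ - 1) (∑ j ∈ Finset.range M, (γ ^ j) y) = (γ ^ M) y - y := by
  induction M with
  | zero => simp
  | succ M ih =>
    rw [Finset.sum_range_succ, map_add, ih, LinearMap.sub_apply, Module.End.one_apply,
      ← Module.End.mul_apply, ← pow_succ']
    abel

/-- `γ^j` commutes with `γ − 1` (pointwise). [folklore] -/
theorem pow_apply_sub_one_apply (x : A) (j : ℕ) :
    (γ ^ j) ((γ - 1) x) = (γ - 1) ((γ ^ j) x) := by
  rw [← Module.End.mul_apply, ← Module.End.mul_apply,
    ((Commute.pow_self γ j).sub_right (Commute.one_right (γ ^ j))).eq]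

/-- `Σ_{i<N} γ^i x = N·x + (γ − 1) D` with `D = Σ_{i<N} Σ_{j<i} γ^j x`. [folklore] -/
theorem sum_pow_apply_eq (x : A) (N : ℕ) :
    ∑ i ∈ Finset.range N, (γ ^ i) x =
      N • x + (γ - 1) (∑ i ∈ Finset.range N, ∑ j ∈ Finset.range i, (γ ^ j) x) := by
  have h : ∀ i : ℕ, (γ ^ i) x = x + (γ - 1) (∑ j ∈ Finset.range i, (γ ^ j) x) := fun i => by
    rw [pow_apply_eq_add_sum γ x i, map_sum]
    congr 1
    exact Finset.sum_congr rfl fun j _ => pow_apply_sub_one_apply γ x j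
  rw [Finset.sum_congr rfl fun i _ => h i, Finset.sum_add_distrib, Finset.sum_const,
    Finset.card_range, map_sum]

/-! ### §2 `γ`-stable subgroups -/

/-- A `γ`-stable subgroup is stable under every power `γ^j`. [folklore] -/
theorem pow_apply_mem {F : AddSubgroup A} (hF : ∀ x ∈ F, γ x ∈ F) {x : A} (hx : x ∈ F) (j : ℕ) :
    (γ ^ j) x ∈ F := by
  induction j with
  | zero => simpa using hx
  | succ j ih => rw [pow_succ', Module.End.mul_apply]; exact hF _ ih

/-- A `γ`-stable subgroup is stable under `γ − 1`. [folklore] -/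
theorem sub_one_apply_mem {F : AddSubgroup A} (hF : ∀ x ∈ F, γ x ∈ F) {x : A} (hx : x ∈ F) :
    (γ - 1) x ∈ F := by
  rw [LinearMap.sub_apply, Module.End.one_apply]
  exact F.sub_mem (hF x hx) hx

/-- A `γ`-stable subgroup is stable under every power `(γ − 1)^j`. [folklore] -/
theorem sub_one_pow_apply_mem {F : AddSubgroup A} (hF : ∀ x ∈ F, γ x ∈ F) {x : A} (hx : x ∈ F)
    (j : ℕ) : ((γ - 1) ^ j) x ∈ F := by
  induction j with
  | zero => simpa using hx
  | succ j ih => rw [pow_succ', Module.End.mul_apply]; exact sub_one_apply_mem γ hF ih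

/-- No `p`-torsion in `N` ⟹ no `p^m`-torsion in `N`. [folklore] -/
theorem noPowTorsion {N : AddSubgroup A} {p : ℕ} (htors : ∀ x ∈ N, p • x = 0 → x = 0) :
    ∀ m : ℕ, ∀ x ∈ N, p ^ m • x = 0 → x = 0
  | 0 => fun x _ h => by simpa using h
  | m + 1 => fun x hx h => by
    rw [pow_succ, mul_nsmul'] at h
    exact htors x hx (noPowTorsion htors m (p • x) (N.nsmul_mem hx p) h)

/-! ### §3 Invariants of a layer quotient vanish -/

/-- **`(V/V')^γ = 0`**: if `γ^{p^{k+1}}` fixes `V`, `γ^{p^k}` fixes `V'`, the points of `V` fixed by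
`γ^{p^k}` lie in `V'` ("`γ` generates the layer quotient"), and `V'` has no `p`-torsion, then a point
`x ∈ V` with `γx − x ∈ V'` lies in `V'`. Proof: `γ^{p^k} x = x + S'` with `S' = Σ_{j<p^k} γ^j(γx − x)`
fixed by `γ`; iterating, `x = γ^{p^{k+1}} x = x + p·S'`, so `S' = 0`. [folklore] -/
theorem mem_of_sub_one_apply_mem {V' V : AddSubgroup A} {p k : ℕ}
    (hV' : ∀ x ∈ V', γ x ∈ V')
    (hfixV : ∀ x ∈ V, (γ ^ p ^ (k + 1)) x = x)
    (hfixV' : ∀ x ∈ V', (γ ^ p ^ k) x = x)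
    (hgen : ∀ x ∈ V, (γ ^ p ^ k) x = x → x ∈ V')
    (htors : ∀ x ∈ V', p • x = 0 → x = 0)
    {x : A} (hx : x ∈ V) (hS : (γ - 1) x ∈ V') : x ∈ V' := by
  set S' : A := ∑ j ∈ Finset.range (p ^ k), (γ ^ j) ((γ - 1) x) with hS'def
  have hS'mem : S' ∈ V' := V'.sum_mem fun j _ => pow_apply_mem γ hV' hS j
  have hgx : (γ ^ p ^ k) x = x + S' := pow_apply_eq_add_sum γ x (p ^ k)
  have hγS' : γ S' = S' := by
    have h := sub_one_apply_sum_pow γ ((γ - 1) x) (p ^ k)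
    rw [hfixV' _ hS, sub_self, LinearMap.sub_apply, Module.End.one_apply, sub_eq_zero] at h
    exact h
  have hpowS' : ∀ j : ℕ, (γ ^ j) S' = S' := fun j => by
    induction j with
    | zero => simp
    | succ j ih => rw [pow_succ', Module.End.mul_apply, ih, hγS']
  have hiter : ∀ i : ℕ, ((γ ^ p ^ k) ^ i) x = x + i • S' := fun i => by
    induction i with
    | zero => simp
    | succ i ih =>
      rw [pow_succ', Module.End.mul_apply, ih, map_add, hgx, map_nsmul, hpowS', succ_nsmul]
      abel
  have hpS' : p • S' = 0 := by
    have h := hiter p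
    rw [← pow_mul, ← pow_succ, hfixV x hx] at h
    exact (add_eq_left.mp h.symm)
  have hS'0 : S' = 0 := htors S' hS'mem hpS'
  have hfix : (γ ^ p ^ k) x = x := by rw [hgx, hS'0, add_zero]
  exact hgen x hx hfix

/-! ### §4 `(γ − 1)^{p^{k+1}} ≡ 0 (mod p)` on a subgroup fixed by `γ^{p^{k+1}}` -/

/-- `((-1)^j) y = (-1)^j • y` in `End_ℤ(A)`. [folklore] -/
theorem neg_one_pow_apply (y : A) (j : ℕ) : ((-1 : Module.End ℤ A) ^ j) y = (-1 : ℤ) ^ j • y := by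
  induction j with
  | zero => simp
  | succ j ih =>
    rw [pow_succ', Module.End.mul_apply, ih, LinearMap.neg_apply, Module.End.one_apply, pow_succ',
      neg_one_mul, neg_smul]

/-- A binomial term `γ^a (−1)^b c` with `p ∣ c` sends `F` into `p•F`. [folklore] -/
theorem exists_term_apply_eq_smul {F : AddSubgroup A} (hF : ∀ x ∈ F, γ x ∈ F) {p c : ℕ}
    (hc : p ∣ c) (a b : ℕ) {x : A} (hx : x ∈ F) :
    ∃ y ∈ F, (γ ^ a * (-1) ^ b * (c : Module.End ℤ A)) x = p • y := by
  obtain ⟨d, rfl⟩ := hc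
  refine ⟨(γ ^ a) (((-1 : Module.End ℤ A) ^ b) (d • x)), pow_apply_mem γ hF ?_ a, ?_⟩
  · rw [neg_one_pow_apply]
    exact F.zsmul_mem (F.nsmul_mem hx d) _
  · rw [Module.End.mul_apply, Module.End.mul_apply, Module.End.natCast_apply, mul_nsmul',
      map_nsmul, map_nsmul]

/-- **`(γ − 1)^{p^{k+1}} x ∈ p•F` for `x` in a `γ`-stable subgroup `F` fixed by `γ^{p^{k+1}}`**
(binomial theorem: the middle coefficients `C(p^{k+1}, i)` are divisible by `p`, the end terms give
`γ^{p^{k+1}}x + (−1)^{p^{k+1}} x = x − x` for odd `p`, `= 2x` for `p = 2`). [folklore] -/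
theorem exists_sub_one_pow_apply_eq_smul {F : AddSubgroup A} {p : ℕ} (hp : p.Prime) (k : ℕ)
    (hF : ∀ x ∈ F, γ x ∈ F) (hfix : ∀ x ∈ F, (γ ^ p ^ (k + 1)) x = x) {x : A} (hx : x ∈ F) :
    ∃ y ∈ F, ((γ - 1) ^ p ^ (k + 1)) x = p • y := by
  set N := p ^ (k + 1) with hN
  have h2N : 2 ≤ N := le_trans hp.two_le (hN ▸ Nat.le_self_pow (Nat.succ_ne_zero k) p)
  obtain ⟨M, hM⟩ : ∃ M, N = M + 2 := ⟨N - 2, by omega⟩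
  have hexp : (γ - 1) ^ N =
      ∑ i ∈ Finset.range (N + 1), γ ^ i * (-1) ^ (N - i) * (N.choose i : Module.End ℤ A) := by
    rw [sub_eq_add_neg, (Commute.neg_one_right γ).add_pow]
  -- middle terms
  have hmid : ∀ i ∈ Finset.range (M + 1), ∃ y ∈ F,
      (γ ^ (i + 1) * (-1) ^ (N - (i + 1)) * (N.choose (i + 1) : Module.End ℤ A)) x = p • y := by
    intro i hi
    rw [Finset.mem_range] at hi
    refine exists_term_apply_eq_smul γ hF ?_ _ _ hx
    rw [hN]
    exact hp.dvd_choose_pow (Nat.succ_ne_zero i) (by rw [← hN]; omega)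
  choose! y hyF hy using hmid
  -- the terms, the end terms
  set T : ℕ → A := fun i => (γ ^ i * (-1) ^ (N - i) * (N.choose i : Module.End ℤ A)) x with hT
  have hend : ∃ y₀ ∈ F, T 0 + T N = p • y₀ := by
    simp only [hT, pow_zero, Nat.sub_zero, Nat.choose_zero_right, Nat.cast_one,
      Nat.sub_self, Nat.choose_self, Module.End.mul_apply, Module.End.one_apply]
    rw [neg_one_pow_apply, hfix x hx]
    rcases hp.eq_two_or_odd' with rfl | hodd
    · refine ⟨x, hx, ?_⟩
      rw [Even.neg_one_pow (by rw [hN]; exact (Nat.even_pow.mpr ⟨even_two, Nat.succ_ne_zero k⟩)),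
        one_smul, two_nsmul]
    · refine ⟨0, F.zero_mem, ?_⟩
      rw [Odd.neg_one_pow (by rw [hN]; exact hodd.pow), neg_one_zsmul, smul_zero, neg_add_cancel]
  obtain ⟨y₀, hy₀F, hy₀⟩ := hend
  have hsplit : ∑ i ∈ Finset.range (N + 1), T i = (∑ i ∈ Finset.range (M + 1), T (i + 1)) + (T 0 + T N) := by
    rw [show Finset.range (N + 1) = Finset.range (M + 2 + 1) by rw [hM], Finset.sum_range_succ,
      Finset.sum_range_succ', ← hM]
    abel
  refine ⟨(∑ i ∈ Finset.range (M + 1), y i) + y₀, F.add_mem (F.sum_mem fun i hi => hyF i hi) hy₀F, ?_⟩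
  rw [hexp, LinearMap.sum_apply]
  change ∑ i ∈ Finset.range (N + 1), T i = _
  rw [hsplit, hy₀, smul_add, Finset.smul_sum, ← Finset.sum_congr rfl fun i hi => hy i hi]

/-! ### §5 From a point not divisible by `p` modulo the lower layer to a non-trivial coinvariant -/

/-- **Witness conversion.** `F' ≤ F` `γ`-stable, `γ^{p^{k+1}}` fixing `F`: if some `w ∈ F` is NOT of
the form `p·a + b` (`a ∈ F`, `b ∈ F'`), then some `u ∈ F` is not of the form `(γ − 1)a + b` — else
`F ⊆ (γ−1)^j F + F'` for every `j`, and `j = p^{k+1}` contradicts §4. [folklore] -/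
theorem exists_not_mem_sup {F' F : AddSubgroup A} {p : ℕ} (hp : p.Prime) (k : ℕ)
    (hF : ∀ x ∈ F, γ x ∈ F) (hF' : ∀ x ∈ F', γ x ∈ F')
    (hfix : ∀ x ∈ F, (γ ^ p ^ (k + 1)) x = x)
    {w : A} (hw : w ∈ F) (hwnot : ¬ ∃ a ∈ F, ∃ b ∈ F', w = p • a + b) :
    ∃ u ∈ F, u ∉ F.map ((γ - 1 : Module.End ℤ A) : A →+ A) ⊔ F' := by
  by_contra hall
  push Not at hall
  have iter : ∀ j : ℕ, ∀ u ∈ F, ∃ a ∈ F, ∃ b ∈ F', u = ((γ - 1) ^ j) a + b := by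
    intro j
    induction j with
    | zero => exact fun u hu => ⟨u, hu, 0, F'.zero_mem, by simp⟩
    | succ j ih =>
      intro u hu
      obtain ⟨a, ha, b, hb, rfl⟩ := ih u hu
      obtain ⟨z, hz, b', hb', hdec⟩ := AddSubgroup.mem_sup.mp (hall a ha)
      obtain ⟨a', ha', rfl⟩ := AddSubgroup.mem_map.mp hz
      refine ⟨a', ha', ((γ - 1) ^ j) b' + b, F'.add_mem (sub_one_pow_apply_mem γ hF' hb' j) hb, ?_⟩
      rw [← hdec, map_add, pow_succ, Module.End.mul_apply, AddMonoidHom.coe_coe]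
      abel
  obtain ⟨a, ha, b, hb, hdec⟩ := iter (p ^ (k + 1)) w hw
  obtain ⟨y, hy, hpy⟩ := exists_sub_one_pow_apply_eq_smul γ hp k hF hfix ha
  exact hwnot ⟨y, hy, b, hb, by rw [hdec, hpy]⟩

/-! ### §6 Coinvariant classes are `p^n`-torsion when the invariants vanish -/

/-- **`p^n · y ∈ (γ − 1)N`** for `y` in a `γ`-stable subgroup `N` fixed by `γ^{p^n}` with `N^γ = 0`:
the "trace" `Σ_{i<p^n} γ^i y` is `γ`-fixed, hence `0`, and equals `p^n y + (γ−1)D`. [folklore] -/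
theorem exists_sub_one_apply_eq_pow_smul {N : AddSubgroup A} {p n : ℕ}
    (hN : ∀ x ∈ N, γ x ∈ N) (hfix : ∀ x ∈ N, (γ ^ p ^ n) x = x)
    (hinv : ∀ z ∈ N, γ z = z → z = 0) {y : A} (hy : y ∈ N) :
    ∃ x ∈ N, (γ - 1) x = p ^ n • y := by
  set T : A := ∑ i ∈ Finset.range (p ^ n), (γ ^ i) y with hTdef
  have hTmem : T ∈ N := N.sum_mem fun i _ => pow_apply_mem γ hN hy i
  have hγT : γ T = T := by
    have h := sub_one_apply_sum_pow γ y (p ^ n)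
    rw [hfix y hy, sub_self, LinearMap.sub_apply, Module.End.one_apply, sub_eq_zero] at h
    exact h
  have hT0 : T = 0 := hinv T hTmem hγT
  set D : A := ∑ i ∈ Finset.range (p ^ n), ∑ j ∈ Finset.range i, (γ ^ j) y with hDdef
  have hD : D ∈ N := N.sum_mem fun i _ => N.sum_mem fun j _ => pow_apply_mem γ hN hy j
  have hsum : T = p ^ n • y + (γ - 1) D := sum_pow_apply_eq γ y (p ^ n)
  refine ⟨-D, N.neg_mem hD, ?_⟩
  rw [map_neg]
  rw [hT0] at hsum
  exact (add_eq_zero_iff_eq_neg.mp hsum.symm).symm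

/-! ### §7 An element of order exactly `p` in a layer coinvariant quotient -/

/-- From `u ∈ F` outside `M = (γ−1)F + F'` with `p^n u ∈ M`: some multiple `u' = p^j u ∈ F` has
`u' ∉ M` and `p·u' ∈ M` (class of order exactly `p`). [folklore] -/
theorem exists_not_mem_and_smul_mem {F : AddSubgroup A} {M : AddSubgroup A} {p : ℕ}
    {u : A} (hu : u ∈ F) (hunot : u ∉ M) {n : ℕ} (hpow : p ^ n • u ∈ M) :
    ∃ u' ∈ F, u' ∉ M ∧ p • u' ∈ M := by
  have hex : ∃ j : ℕ, p ^ j • u ∈ M := ⟨n, hpow⟩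
  have hj₀ : p ^ Nat.find hex • u ∈ M := Nat.find_spec hex
  have hj₀ne : Nat.find hex ≠ 0 := fun h => by
    rw [h, pow_zero, one_smul] at hj₀
    exact hunot hj₀
  obtain ⟨j, hj⟩ : ∃ j, Nat.find hex = j + 1 := Nat.exists_eq_succ_of_ne_zero hj₀ne
  refine ⟨p ^ j • u, F.nsmul_mem hu _, ?_, ?_⟩
  · exact Nat.find_min hex (show j < Nat.find hex by omega)
  · rw [smul_smul, ← pow_succ', ← hj]
    exact hj₀


/-! ### §8 Two bookkeeping lemmas for the finset count (file 80) -/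

section Finset

variable (f : A →+ A)

/-- **Layer step WITHOUT a witness**: distinctness modulo `f(F')` passes to `f(F)` by the
injectivity of coinvariants along `F' → F`. [folklore] -/
theorem finset_step_noWitness {F' F : AddSubgroup A}
    (hinj : ∀ x ∈ F, f x ∈ F' → x ∈ F')
    (Y : Finset A) (hYF' : ∀ y ∈ Y, y ∈ F')
    (hYdist : ∀ y ∈ Y, ∀ y' ∈ Y, y - y' ∈ F'.map f → y = y') :
    ∀ y ∈ Y, ∀ y' ∈ Y, y - y' ∈ F.map f → y = y' := by
  intro y hy y' hy' hmem
  obtain ⟨x, hx, hfx⟩ := AddSubgroup.mem_map.mp hmem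
  have hxF' : x ∈ F' := hinj x hx (hfx ▸ F'.sub_mem (hYF' y hy) (hYF' y' hy'))
  exact hYdist y hy y' hy' (AddSubgroup.mem_map.mpr ⟨x, hxF', hfx⟩)

/-- Bookkeeping: `#{k ∈ S | k ≤ n + 1} = #{k ∈ S | k ≤ n} + [n + 1 ∈ S]`. [folklore] -/
theorem card_filter_le_succ (S : Finset ℕ) (n : ℕ) :
    (S.filter (· ≤ n + 1)).card = (S.filter (· ≤ n)).card + (if n + 1 ∈ S then 1 else 0) := by
  have hsplit : S.filter (· ≤ n + 1) = S.filter (· ≤ n) ∪ S.filter (· = n + 1) := by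
    ext k
    simp only [Finset.mem_filter, Finset.mem_union]
    constructor
    · rintro ⟨hk, hle⟩
      rcases Nat.lt_or_ge k (n + 1) with h | h
      · exact Or.inl ⟨hk, by omega⟩
      · exact Or.inr ⟨hk, by omega⟩
    · rintro (⟨hk, h⟩ | ⟨hk, h⟩) <;> exact ⟨hk, by omega⟩
  have hdisj : Disjoint (S.filter (· ≤ n)) (S.filter (· = n + 1)) := by
    rw [Finset.disjoint_filter]
    intro k _ h; omega
  rw [hsplit, Finset.card_union_of_disjoint hdisj]
  congr 1
  split_ifs with h
  · rw [Finset.card_eq_one]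
    exact ⟨n + 1, by ext k; simp [Finset.mem_filter]; rintro rfl; exact h⟩
  · rw [Finset.card_eq_zero, Finset.filter_eq_empty_iff]
    rintro k hk rfl
    exact h hk

end Finset

end Summit.BirchSwinnertonDyer.Rank1Residual.Additive.InvariantCount

end
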